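import Summits.ValiantsHypothesis.ValiantsHypothesis.Theorems.DefinabilityGapCrowdedUnion
import Summits.ValiantsHypothesis.ValiantsHypothesis.Theorems.DefinabilityGapFewBadReadout
import Summits.ValiantsHypothesis.ValiantsHypothesis.Theorems.DefinabilityGapPivotGoodUnion
import HarnessLib

/-!
# Definability gap, ROAD P: Phase A existence — good AND crowded lines (N1 v2 (b)+(c)+(e))

The probabilistic method on the product space of admissible row assignments
(`DefinabilityGapPivotPhaseA.exists_adm_not_mem`) applied to the union of FOUR event families:
row / column over-load on light positions (`DefinabilityGapPivotGoodUnion`) and too few free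
columns / rows on lines with at least `n₀` light positions (`DefinabilityGapCrowdedUnion`).
All constants stay symbolic; the numeric side conditions are the hypotheses `hbudget`, `hB`,
`hsmall` (to be discharged for `p = 8/(5m)`, `N = 32m`, `M = m/8`, `L = m/4`, … in the
assembly).

* `weight_union_le`: sub-additivity of the product weight;
* **`exists_adm_phaseA`**: an admissible `r` off all four event families;
* **`exists_adm_fewBad_clauses`**: if moreover the admissible sets obey the row rule for the
  threshold `N`, `n₀ + B ≤ m + 1` and `2 #T ≤ M L B`, then some admissible `r` satisfies the
  two few-bad clauses of `kiPivotCertificate_of_fewBad` for EVERY pivot column `s₀`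
  (`DefinabilityGapFewBadReadout.fewBad_clauses`) — only injective pivots remain;
* **`exists_rowRule_fewBad_clauses`**: the same with the canonical admissible sets
  `A c = (heavyRows T c N)ᶜ` (`2 #T ≤ N k`, `k < m`, `1/(m − k) ≤ p`);
* `pivots_injective_iff`: what the alteration stages must still achieve — injective pivots in
  column `s₀` ⟺ `s₀ ∈ freeCols T c r (r c)` for every `c ∈ T`.
-/

namespace Summit.ValiantsHypothesis.ValiantsHypothesis.Theorems.DefinabilityGapPhaseAExists

open Finset Real Literature.Probability.Moments
open Literature.Computability.AlgebraicComplexity Literature.Computability.MetaComplexity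
open Summit.ValiantsHypothesis.ValiantsHypothesis.Theorems.DefinabilityGapAffineRung
open Summit.ValiantsHypothesis.ValiantsHypothesis.Theorems.DefinabilityGapPivotCertificate
open Summit.ValiantsHypothesis.ValiantsHypothesis.Theorems.DefinabilityGapPivotLive
open Summit.ValiantsHypothesis.ValiantsHypothesis.Theorems.DefinabilityGapPivotLiveWeak
open Summit.ValiantsHypothesis.ValiantsHypothesis.Theorems.DefinabilityGapPivotLiveBad
open Summit.ValiantsHypothesis.ValiantsHypothesis.Theorems.DefinabilityGapPivotAdmissible
open Summit.ValiantsHypothesis.ValiantsHypothesis.Theorems.DefinabilityGapPivotPhaseA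
open Summit.ValiantsHypothesis.ValiantsHypothesis.Theorems.DefinabilityGapPivotGoodLines
open Summit.ValiantsHypothesis.ValiantsHypothesis.Theorems.DefinabilityGapPivotCrowded
open Summit.ValiantsHypothesis.ValiantsHypothesis.Theorems.DefinabilityGapPivotGoodUnion
open Summit.ValiantsHypothesis.ValiantsHypothesis.Theorems.DefinabilityGapCrowdedFree
open Summit.ValiantsHypothesis.ValiantsHypothesis.Theorems.DefinabilityGapCrowdedUnion
open Summit.ValiantsHypothesis.ValiantsHypothesis.Theorems.DefinabilityGapFewBadReadout

variable {m : ℕ}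

/-- Sub-additivity of a nonnegative weight over a union. [this file] -/
theorem weight_union_le {ι : Type*} [DecidableEq ι] (S₁ S₂ : Finset ι) {f : ι → ℝ}
    (hf : ∀ x, 0 ≤ f x) : ∑ x ∈ S₁ ∪ S₂, f x ≤ ∑ x ∈ S₁, f x + ∑ x ∈ S₂, f x := by
  rw [← Finset.sum_union_inter]
  have : 0 ≤ ∑ x ∈ S₁ ∩ S₂, f x := Finset.sum_nonneg fun x _ => hf x
  linarith

open scoped Classical in
/-- **PHASE A (good and crowded lines).**  Admissible sets `A c` of at least `1/p` rows each
(`p ≤ 1/2`); budget `2(L + pmM + t) ≤ m`; `2 ≤ s ≤ n₀`, `B ≤ e^{−2pN} s/2 − 2(4pNs²/n₀ + t')`; the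
four union bounds summing to `< 1`.  Then some admissible row assignment has, for every pivot
column, `M L #badRows ≤ 2(#T − 1)` and `M L #badCols ≤ 2(#T − 1)` for every curve, and at least
`B` free columns (rows) on every row (column) with at least `n₀` light positions. [this file] -/
theorem exists_adm_phaseA (T : Finset (Fin 3 → Fin (qOf m)))
    (A : (Fin 3 → Fin (qOf m)) → Finset (Fin m)) (hA : ∀ c, (A c).Nonempty) {p : ℝ}
    (hp0 : 0 < p) (hp : p ≤ 1 / 2) (hAp : ∀ c, 1 / ((A c).card : ℝ) ≤ p) {M L : ℕ}
    (hM : 0 < M) (hm : 0 < m) {t : ℝ} (ht : 0 < t)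
    (hbudget : 2 * ((L : ℝ) + (p * ((m : ℝ) * M) + t)) ≤ m) {N : ℕ} (hN : 0 < N) {s n₀ : ℕ}
    (hs : 2 ≤ s) (hsn : s ≤ n₀) {t' B : ℝ} (ht' : 0 < t')
    (hB : B ≤ exp (-(2 * p * N)) * s / 2 - 2 * (4 * p * N * (s : ℝ) ^ 2 / n₀ + t'))
    (hsmall : (T.card : ℝ) * m * exp (-(t ^ 2 / (2 * (2 * (p * ((m : ℝ) * M)) + 2 * t / 3))))
      + (T.card : ℝ) * m * exp (-(t ^ 2 / (2 * (p * ((m : ℝ) * M) + 1 * t / 3))))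
      + 2 * ((T.card : ℝ) * m * (exp (-(exp (-(2 * p * N)) * s / 8)) +
          exp (-(t' ^ 2 / (2 * (4 * p * N * (s : ℝ) ^ 2 / n₀ + 1 * t' / 3)))))) < 1) :
    ∃ r : (Fin 3 → Fin (qOf m)) → Fin m, (∀ c, r c ∈ A c) ∧
      (∀ s₀ : Fin m, ∀ c ∈ T,
        M * L * (badRows (pivotZeros m T s₀ r) c (r c) s₀).card ≤ 2 * (T.erase c).card ∧
        M * L * (badCols (pivotZeros m T s₀ r) c (r c) s₀).card ≤ 2 * (T.erase c).card) ∧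
      (∀ c ∈ T, ∀ i : Fin m, n₀ ≤ (lightCols T c N i).card →
        B ≤ ((freeCols T c r i).card : ℝ)) ∧
      (∀ c ∈ T, ∀ j : Fin m, n₀ ≤ (lightRows T c N j).card →
        B ≤ ((freeRows T c r j).card : ℝ)) := by
  set w := admWeight A with hw_def
  have hw : ∀ c a, 0 ≤ w c a := admWeight_nonneg A
  have hw1 : ∀ c, ∑ a, w c a = 1 := sum_admWeight A hA
  have hwp : ∀ c', w c' ≤ fun _ => p := fun c' a => (admWeight_le A c' a).trans (hAp c')
  have hwp' : ∀ c' a, w c' a ≤ p := fun c' a => (admWeight_le A c' a).trans (hAp c')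
  set ER := (Finset.univ : Finset ((Fin 3 → Fin (qOf m)) → Fin m)).filter
    (fun r => ∃ c ∈ T, ∃ i : Fin m, p * ((m : ℝ) * M) + t ≤
      ∑ c', rowKillOn (lightCols T c M i) T c i c' (r c')) with hER
  set EC := (Finset.univ : Finset ((Fin 3 → Fin (qOf m)) → Fin m)).filter
    (fun r => ∃ c ∈ T, ∃ j : Fin m, p * ((m : ℝ) * M) + t ≤
      ∑ c', colKillOn (lightRows T c M j) T c j c' (r c')) with hEC
  set EF := (Finset.univ : Finset ((Fin 3 → Fin (qOf m)) → Fin m)).filter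
    (fun r => ∃ c ∈ T, ∃ i : Fin m, n₀ ≤ (lightCols T c N i).card ∧
      ((freeCols T c r i).card : ℝ) < B) with hEF
  set EG := (Finset.univ : Finset ((Fin 3 → Fin (qOf m)) → Fin m)).filter
    (fun r => ∃ c ∈ T, ∃ j : Fin m, n₀ ≤ (lightRows T c N j).card ∧
      ((freeRows T c r j).card : ℝ) < B) with hEG
  have hR := weight_exists_rowOver_le hw hw1 hp0 hwp T hM hm ht
  have hC := weight_exists_colOver_le hw hw1 hp0 hwp T hM hm ht
  have hF := weight_exists_fewFreeCols_le hw hw1 hp0 hp hwp' T hN hs hsn ht' hB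
  have hG := weight_exists_fewFreeRows_le hw hw1 hp0 hp hwp' T hN hs hsn ht' hB
  have hnn : ∀ r, 0 ≤ prodWeight w r := prodWeight_nonneg hw
  have hunion : ∑ r ∈ ((ER ∪ EC) ∪ EF) ∪ EG, prodWeight w r ≤
      ∑ r ∈ ER, prodWeight w r + ∑ r ∈ EC, prodWeight w r +
        ∑ r ∈ EF, prodWeight w r + ∑ r ∈ EG, prodWeight w r := by
    have h1 := weight_union_le ((ER ∪ EC) ∪ EF) EG hnn
    have h2 := weight_union_le (ER ∪ EC) EF hnn
    have h3 := weight_union_le ER EC hnn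
    linarith
  have hlt : ∑ r ∈ ((ER ∪ EC) ∪ EF) ∪ EG, prodWeight (admWeight A) r < 1 := by
    have h := hunion
    rw [hw_def] at h hR hC hF hG
    linarith
  obtain ⟨r, hr, hadm⟩ := exists_adm_not_mem A hA (((ER ∪ EC) ∪ EF) ∪ EG) hlt
  have hrR : ∀ c ∈ T, ∀ i : Fin m,
      ∑ c', rowKillOn (lightCols T c M i) T c i c' (r c') < p * ((m : ℝ) * M) + t := by
    intro c hc i
    by_contra hge
    exact hr (Finset.mem_union_left _ (Finset.mem_union_left _ (Finset.mem_union_left _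
      (Finset.mem_filter.mpr ⟨Finset.mem_univ _, c, hc, i, not_lt.mp hge⟩))))
  have hrC : ∀ c ∈ T, ∀ j : Fin m,
      ∑ c', colKillOn (lightRows T c M j) T c j c' (r c') < p * ((m : ℝ) * M) + t := by
    intro c hc j
    by_contra hge
    exact hr (Finset.mem_union_left _ (Finset.mem_union_left _ (Finset.mem_union_right _
      (Finset.mem_filter.mpr ⟨Finset.mem_univ _, c, hc, j, not_lt.mp hge⟩))))
  have hrF : ∀ c ∈ T, ∀ i : Fin m, n₀ ≤ (lightCols T c N i).card →
      B ≤ ((freeCols T c r i).card : ℝ) := by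
    intro c hc i hi
    by_contra hlt'
    exact hr (Finset.mem_union_left _ (Finset.mem_union_right _
      (Finset.mem_filter.mpr ⟨Finset.mem_univ _, c, hc, i, hi, not_le.mp hlt'⟩)))
  have hrG : ∀ c ∈ T, ∀ j : Fin m, n₀ ≤ (lightRows T c N j).card →
      B ≤ ((freeRows T c r j).card : ℝ) := by
    intro c hc j hj
    by_contra hlt'
    exact hr (Finset.mem_union_right _
      (Finset.mem_filter.mpr ⟨Finset.mem_univ _, c, hc, j, hj, not_le.mp hlt'⟩))
  exact ⟨r, hadm, fun s₀ c hc =>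
    ⟨mul_card_badRows_le_of_not_over T s₀ r M L hrR hbudget hc,
      mul_card_badCols_le_of_not_over T s₀ r M L hrC hbudget hc⟩, hrF, hrG⟩

open scoped Classical in
/-- **PHASE A ⟹ the few-bad clauses for every pivot column.**  If moreover the admissible sets
obey the row rule for the threshold `N`, `n₀ + B ≤ m + 1` and `2 #T ≤ M L B` (so that
`#bad + 1 ≤ B`), then some admissible `r` satisfies the hypotheses `hcolbad`, `hrowbad` of
`kiPivotCertificate_of_fewBad` for every `s₀`. [this file] -/
theorem exists_adm_fewBad_clauses (T : Finset (Fin 3 → Fin (qOf m)))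
    (A : (Fin 3 → Fin (qOf m)) → Finset (Fin m)) (hA : ∀ c, (A c).Nonempty) {N : ℕ}
    (hN : 0 < N) (hArule : ∀ c, ∀ a ∈ A c, a ∉ heavyRows T c N) {p : ℝ} (hp0 : 0 < p)
    (hp : p ≤ 1 / 2) (hAp : ∀ c, 1 / ((A c).card : ℝ) ≤ p) {M L : ℕ} (hM : 0 < M)
    (hm : 0 < m) {t : ℝ} (ht : 0 < t) (hbudget : 2 * ((L : ℝ) + (p * ((m : ℝ) * M) + t)) ≤ m)
    {s n₀ B : ℕ} (hs : 2 ≤ s) (hsn : s ≤ n₀) (hn₀ : n₀ + B ≤ m + 1)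
    (hMLB : 2 * T.card ≤ M * L * B) {t' : ℝ} (ht' : 0 < t')
    (hB : (B : ℝ) ≤ exp (-(2 * p * N)) * s / 2 - 2 * (4 * p * N * (s : ℝ) ^ 2 / n₀ + t'))
    (hsmall : (T.card : ℝ) * m * exp (-(t ^ 2 / (2 * (2 * (p * ((m : ℝ) * M)) + 2 * t / 3))))
      + (T.card : ℝ) * m * exp (-(t ^ 2 / (2 * (p * ((m : ℝ) * M) + 1 * t / 3))))
      + 2 * ((T.card : ℝ) * m * (exp (-(exp (-(2 * p * N)) * s / 8)) +
          exp (-(t' ^ 2 / (2 * (4 * p * N * (s : ℝ) ^ 2 / n₀ + 1 * t' / 3)))))) < 1) :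
    ∃ r : (Fin 3 → Fin (qOf m)) → Fin m, (∀ c, r c ∈ A c) ∧ ∀ s₀ : Fin m,
      (∀ c ∈ T, ∀ j ∈ badCols (pivotZeros m T s₀ r) c (r c) s₀,
          (badCols (pivotZeros m T s₀ r) c (r c) s₀).card ≤
            (okRows (pivotZeros m T s₀ r) c (r c) j).card) ∧
        (∀ c ∈ T, ∀ i ∈ badRows (pivotZeros m T s₀ r) c (r c) s₀,
          (badRows (pivotZeros m T s₀ r) c (r c) s₀).card +
            (deadCols (pivotZeros m T s₀ r) c s₀ i).card + 1 ≤ m) := by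
  obtain ⟨r, hadm, hbad, hF, hG⟩ := exists_adm_phaseA T A hA hp0 hp hAp hM hm ht hbudget hN
    hs hsn ht' hB hsmall
  have hrule : ∀ c' ∈ T, r c' ∉ heavyRows T c' N := fun c' _ => hArule c' (r c') (hadm c')
  have hlt_of : ∀ {k : ℕ} {c : Fin 3 → Fin (qOf m)}, c ∈ T →
      M * L * k ≤ 2 * (T.erase c).card → k + 1 ≤ B := by
    intro k c hc hk
    have h1 : (T.erase c).card + 1 = T.card := Finset.card_erase_add_one hc
    have h2 : M * L * k < M * L * B := by omega
    exact Nat.lt_of_mul_lt_mul_left h2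
  refine ⟨r, hadm, fun s₀ => fewBad_clauses T s₀ r hrule hn₀ (fun c hc => ?_) (fun c hc => ?_)
    (fun c hc i hi => ?_) (fun c hc j hj => ?_)⟩
  · exact hlt_of hc (hbad s₀ c hc).1
  · exact hlt_of hc (hbad s₀ c hc).2
  · exact_mod_cast hF c hc i hi
  · exact_mod_cast hG c hc j hj

open scoped Classical in
/-- **PHASE A with the canonical admissible sets** `A c = (heavyRows T c N)ᶜ`: if
`2 #T ≤ N k` with `k < m` (so every `A c` has at least `m − k ≥ 1/p` rows), the numeric side
conditions of `exists_adm_fewBad_clauses` yield an `r` obeying the row rule for `N` and the two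
few-bad clauses for every pivot column. [this file] -/
theorem exists_rowRule_fewBad_clauses (T : Finset (Fin 3 → Fin (qOf m))) {N k : ℕ}
    (hN : 0 < N) (hk : 2 * T.card ≤ N * k) (hkm : k < m) {p : ℝ} (hp0 : 0 < p)
    (hp : p ≤ 1 / 2) (hAp : 1 / ((m - k : ℕ) : ℝ) ≤ p) {M L : ℕ} (hM : 0 < M) {t : ℝ}
    (ht : 0 < t) (hbudget : 2 * ((L : ℝ) + (p * ((m : ℝ) * M) + t)) ≤ m) {s n₀ B : ℕ}
    (hs : 2 ≤ s) (hsn : s ≤ n₀) (hn₀ : n₀ + B ≤ m + 1) (hMLB : 2 * T.card ≤ M * L * B)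
    {t' : ℝ} (ht' : 0 < t')
    (hB : (B : ℝ) ≤ exp (-(2 * p * N)) * s / 2 - 2 * (4 * p * N * (s : ℝ) ^ 2 / n₀ + t'))
    (hsmall : (T.card : ℝ) * m * exp (-(t ^ 2 / (2 * (2 * (p * ((m : ℝ) * M)) + 2 * t / 3))))
      + (T.card : ℝ) * m * exp (-(t ^ 2 / (2 * (p * ((m : ℝ) * M) + 1 * t / 3))))
      + 2 * ((T.card : ℝ) * m * (exp (-(exp (-(2 * p * N)) * s / 8)) +
          exp (-(t' ^ 2 / (2 * (4 * p * N * (s : ℝ) ^ 2 / n₀ + 1 * t' / 3)))))) < 1) :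
    ∃ r : (Fin 3 → Fin (qOf m)) → Fin m, (∀ c, r c ∉ heavyRows T c N) ∧ ∀ s₀ : Fin m,
      (∀ c ∈ T, ∀ j ∈ badCols (pivotZeros m T s₀ r) c (r c) s₀,
          (badCols (pivotZeros m T s₀ r) c (r c) s₀).card ≤
            (okRows (pivotZeros m T s₀ r) c (r c) j).card) ∧
        (∀ c ∈ T, ∀ i ∈ badRows (pivotZeros m T s₀ r) c (r c) s₀,
          (badRows (pivotZeros m T s₀ r) c (r c) s₀).card +
            (deadCols (pivotZeros m T s₀ r) c s₀ i).card + 1 ≤ m) := by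
  set A : (Fin 3 → Fin (qOf m)) → Finset (Fin m) := fun c => (heavyRows T c N)ᶜ with hA_def
  have hcard : ∀ c, m - k ≤ (A c).card := fun c => le_card_compl_heavyRows T c hk hN
  have hA : ∀ c, (A c).Nonempty := fun c =>
    Finset.card_pos.mp (lt_of_lt_of_le (by omega) (hcard c))
  have hArule : ∀ c, ∀ a ∈ A c, a ∉ heavyRows T c N := fun c a ha => Finset.mem_compl.mp ha
  have hAp' : ∀ c, 1 / ((A c).card : ℝ) ≤ p := by
    intro c
    refine le_trans ?_ hAp
    have hpos : (0 : ℝ) < ((m - k : ℕ) : ℝ) := by exact_mod_cast (show 0 < m - k by omega)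
    exact one_div_le_one_div_of_le hpos (by exact_mod_cast hcard c)
  have hm : 0 < m := by omega
  obtain ⟨r, hadm, h⟩ := exists_adm_fewBad_clauses T A hA hN hArule hp0 hp hAp' hM hm ht
    hbudget hs hsn hn₀ hMLB ht' hB hsmall
  exact ⟨r, fun c => hArule c (r c) (hadm c), h⟩

/-! ## What remains: injective pivots = a column free at every pivot row -/

/-- **Injective pivots ⟺ the pivot column is a free column of every pivot row.**  The pivots
`cellEmb c (r c, s₀)`, `c ∈ T`, are pairwise distinct iff for every `c ∈ T` no co-curve through
the pivot cell of `c` is assigned the pivot row of `c`, i.e. `s₀ ∈ freeCols T c r (r c)` — the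
target of the alteration stages. [this file] -/
theorem pivots_injective_iff (T : Finset (Fin 3 → Fin (qOf m))) (s₀ : Fin m)
    (r : (Fin 3 → Fin (qOf m)) → Fin m) :
    (∀ c ∈ T, ∀ c' ∈ T, cellEmb m c (r c, s₀) = cellEmb m c' (r c', s₀) → c = c') ↔
      ∀ c ∈ T, s₀ ∈ freeCols T c r (r c) := by
  constructor
  · intro hinj c hc
    refine mem_freeCols.mpr fun c' hc' hrc' => ?_
    obtain ⟨hc'T, hne, he⟩ := mem_coCurves.mp hc'
    refine hne (hinj c hc c' hc'T ?_).symm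
    rw [hrc', he]
  · intro hfree c hc c' hc' he
    by_contra hne
    have hpos : (r c, s₀) = (r c', s₀) := pos_eq_of_cellEmb_eq m he
    have hrr : r c' = r c := (congrArg Prod.fst hpos).symm
    have hc'co : c' ∈ coCurves T c (r c, s₀) := by
      refine mem_coCurves.mpr ⟨hc', fun h => hne h.symm, ?_⟩
      rw [he, hrr]
    exact mem_freeCols.mp (hfree c hc) c' hc'co hrr

end Summit.ValiantsHypothesis.ValiantsHypothesis.Theorems.DefinabilityGapPhaseAExists
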